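import Summits.BirchSwinnertonDyer.BirchSwinnertonDyer.Theorems.ErratumRoadFiveShimuraKolyvaginOrderBoundInertCarrierChoiceFree
import HarnessLib

/-!
# «ONE presentation ⟹ ALL»: Gross's Prop. 3.6 coset transfer for Kolyvagin's point over an ARBITRARY subgroup `H′ ≤ Gal(K[k]∕K[1])`
# with ANY section — the dictionary entry behind the exact order of the labelled classes (hκ0 ∕ hκt) of the Jetchev-walk engines
# (cell `bsd-stepL`, seat `bsd-stepL-corner3-p2` g8 = WIDTH-LEVER lane B; `--supports stmt-BirchSwinnertonDyer-21420 --as helper`)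

WHY (PORT-SPEC §3c (a), HOME/corner3/g7/CORNER3-G7.md). The port target currency `ShimuraWalk.PDiv hK ι W ys p k′ μ` (p592703) asks
`p^μ ∣ P_{k′}(σ′, H′, f′)` for EVERY presentation of Kolyvagin's operator at level `k′`: any system of generators `σ′_q` of the
`G(q) = Gal(K[k′]∕K[k′∕q])` with `σ′_q^{q+1} = 1`, ANY subgroup `H′ ≤ H_c := Gal(K[k′]∕K[1])` (pulled back to `𝒢`) and ANY section `f′`
of `𝒢 → 𝒢∕H′`. The carrier of the labelled CM family (`hpointsRk_of_shimuraLabels_of_noTorsion_walk`, p594479) produces ONE presentation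
(transversal-valued section, shim-p1's telescope). Clause (1) of the carrier («all ⟹ one») is instantiation; the converse («one ⟹ all»),
needed for the EXACT order `addOrderOf c_{p^k}(P_{k′}) = p^{k − m′(k′)}` of the labelled classes (the `hκt` order clause of the per-level
engine p593074 and `hκ0` of the swap engine p593233), is THIS FILE:
* §1 `KolyvaginCoset.sum_section_smul_sub_relIndex_smul_sum_mem` — the COSET-REFINEMENT form of Gross's coset-representative argument
  (the tree's `KolyvaginEuler.sum_smul_sub_sum_smul_mem` compares two sections of the SAME subgroup): for `H′ ≤ H`, `x` fixed by `H`
  modulo a `G`-stable subgroup `B`, a section `f` of `G∕H` and a section `f′` of `G∕H′`,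
  `Σ_{c ∈ G∕H′} f′(c)·x − [H : H′]·Σ_{C ∈ G∕H} f(C)·x ∈ B` — via Mathlib's `Subgroup.quotientEquivProdOfLE′` (`G∕H′ ≃ G∕H × H∕H′`
  built on the section `f`); and its reading on Kolyvagin's point, `kolyvaginPoint_sub_relIndex_smul_kolyvaginPoint_mem`
  (`P(σ, H′, f′) − [H : H′]·P(σ, H, f) ∈ nA` under the hypotheses of `KolyvaginEuler.smul_kolyvaginPoint_sub_mem` for `(σ, H)`).
* §2 `exists_kolyvaginPoint_eq_smul_add_of_presentation` — in the concrete ring-class frame of shim-p1's K4d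
  (`exists_isCoprime_kolyvaginPoint_eq_of_presentations_of_pow_eq_one`: `𝒢 ↪ 𝒢_k` acting on `A₀ ≃ E(K[k])`, level `k` square-free on
  Kolyvagin primes of depth `M`, the weak (B4) label): for a TRANSVERSAL presentation `(σ₁, H₁, f₁, S₁)` and an ARBITRARY one
  `(σ₂, H₂ ≤ H_c, f₂)` with `σ₂_q^{q+1} = 1`, `P₂ = c • P₁ + p^M • b` for some `c : ℤ`, `b : A₀` (`c = [H_c : H₂]·u`, `u` the rescaling
  unit of K4d; only the existence of `c` is recorded). Proof: K4d between `(σ₁, H₁, f₁)` and `(σ₂, H_c, g)` (`g` a section of `H_c` valued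
  in `S₁`), then §1 between `(σ₂, H_c, g)` and `(σ₂, H₂, f₂)` with `x := D_{σ₂} y`, `H_c`-fixed mod `p^M` by Gross 3.6
  (`smul_grAct_derivProd_sub_mem` on the generators, `smul_sub_mem_of_mem_closure`, K4a `le_closure_of_map_zpowers`).
* §3 `exists_smul_eq_kolyvaginPoint_of_presentation` — hence for `μ ≤ M`: `p^μ ∣ P₁ ⟹ p^μ ∣ P₂` («one ⟹ all»; (DIV) is not
  mis-stated: a smaller `H′` only multiplies by the index).
HONEST FRAMING: theorems only (no definition, no named fact, no `sorry`); group-ring ∕ ring-class bookkeeping; nothing about any curve's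
arithmetic; no stub closes; BSD is not proved by any of this; T7. Credit: shim-p1 g8 (K4a–K4d), x11b3 (choice independence, H37 bridge).
References: [cite: GrossLMS1991, §3 Prop. 3.6, §4 (4.1)] [cite: McCallumLMS1991, §4 (4), §5 p. 303 («P_n ∈ p^M E(K_n)»)]
[cite: BertoliniDarmon1996, §2.4].
presearch: «independence of Kolyvagin's P_n of the coset representatives ∕ subgroup» → [corpus: GrossLMS1991 §4 (4.1), Prop. 3.6] gives the
H-fixedness; the index form for a smaller subgroup is folklore bookkeeping (none in corpus+galaxy as a statement; queries "coset representatives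
Kolyvagin derivative independent", "P_n independent choice"); tree: `KolyvaginEuler.sum_smul_sub_sum_smul_mem` (same subgroup only).
-/

noncomputable section

open scoped Classical

set_option linter.dupNamespace false
set_option autoImplicit false

/-! ### §1 The coset-refinement lemma (abstract) -/

namespace Summit.BirchSwinnertonDyer.BirchSwinnertonDyer.Theorems.KolyvaginCoset

open Finset Literature.NumberTheory.EllipticCurves.KolyvaginEuler

variable {G : Type*} [Group G] {X : Type*} [AddCommGroup X] [DistribMulAction G X]

/-- **Coset refinement** (Gross 1991 (4.1), the coset-representative argument, for a SMALLER subgroup): if `x` is fixed modulo the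
`G`-stable subgroup `B` by `H`, `H′ ≤ H`, `f` is a section of `G → G∕H` and `f′` a section of `G → G∕H′`, then
`Σ_{c ∈ G∕H′} f′(c)·x − [H : H′]·Σ_{C ∈ G∕H} f(C)·x ∈ B`: along `G∕H′ ≃ G∕H × H∕H′` (Mathlib's `Subgroup.quotientEquivProdOfLE′` on the
section `f`) the representative `f′(c)` of the coset `c ↔ (C, hH′)` is `f(C)·h·h′` with `h·h′ ∈ H`, so `f′(c)·x ≡ f(C)·x (mod B)`, and each
`C` has `[H : H′]` preimages. [cite: GrossLMS1991, §4 (4.1), Prop. 5.4 (proof: independence of S)] -/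
theorem sum_section_smul_sub_relIndex_smul_sum_mem {H H' : Subgroup G} [Fintype (G ⧸ H)] [Fintype (G ⧸ H')]
    (hle : H' ≤ H) {B : AddSubgroup X} (hB : ∀ (g : G), ∀ b ∈ B, g • b ∈ B) {x : X}
    (hx : ∀ h ∈ H, h • x - x ∈ B) (f : G ⧸ H → G) (hf : ∀ q, (f q : G ⧸ H) = q)
    (f' : G ⧸ H' → G) (hf' : ∀ q, (f' q : G ⧸ H') = q) :
    ∑ q, f' q • x - (H'.relIndex H : ℤ) • ∑ q, f q • x ∈ B := by
  set e : G ⧸ H' ≃ (G ⧸ H) × H ⧸ H'.subgroupOf H := Subgroup.quotientEquivProdOfLE' hle f hf with he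
  haveI : Finite (H ⧸ H'.subgroupOf H) :=
    Finite.of_surjective (fun c : G ⧸ H' ↦ (e c).2) fun d ↦ ⟨e.symm ((1 : G) , d), by simp⟩
  letI : Fintype (H ⧸ H'.subgroupOf H) := Fintype.ofFinite _
  -- the representative `f′(e⁻¹(C, d))` differs from `f(C)` by an element of `H`
  have hmem : ∀ a : (G ⧸ H) × H ⧸ H'.subgroupOf H, (f a.1)⁻¹ * f' (e.symm a) ∈ H := by
    rintro ⟨C, d⟩
    induction d using QuotientGroup.induction_on with
    | H b =>
      have hs : e.symm (C, (b : H ⧸ H'.subgroupOf H)) = ((f C * b : G) : G ⧸ H') := by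
        rw [he, Subgroup.quotientEquivProdOfLE'_symm_apply]
        rfl
      have h2 : (f C * b)⁻¹ * f' (e.symm (C, (b : H ⧸ H'.subgroupOf H))) ∈ H' := by
        rw [← QuotientGroup.eq, hf', hs]
      have h3 : (f C)⁻¹ * f' (e.symm (C, (b : H ⧸ H'.subgroupOf H))) =
          b * ((f C * b)⁻¹ * f' (e.symm (C, (b : H ⧸ H'.subgroupOf H)))) := by
        rw [mul_inv_rev, ← mul_assoc, ← mul_assoc, mul_inv_cancel, one_mul]
      rw [h3]
      exact H.mul_mem b.2 (hle h2)
  -- reindex the first sum along `e`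
  have h1 : ∑ a : (G ⧸ H) × H ⧸ H'.subgroupOf H, f' (e.symm a) • x = ∑ q, f' q • x :=
    Fintype.sum_equiv e.symm _ _ fun _ ↦ rfl
  have key : ∀ a : (G ⧸ H) × H ⧸ H'.subgroupOf H,
      f' (e.symm a) • x = f a.1 • x + f a.1 • ((((f a.1)⁻¹ * f' (e.symm a)) • x) - x) := fun a ↦ by
    rw [smul_sub, ← mul_smul, mul_inv_cancel_left, add_sub_cancel]
  -- the second sum, fibrewise constant
  have h2 : ∑ a : (G ⧸ H) × H ⧸ H'.subgroupOf H, f a.1 • x = (H'.relIndex H : ℤ) • ∑ q, f q • x := by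
    rw [Fintype.sum_prod_type, Finset.smul_sum]
    refine Finset.sum_congr rfl fun C _ ↦ ?_
    simp only [Finset.sum_const, Finset.card_univ]
    rw [← natCast_zsmul]
    congr 1
    rw [Subgroup.relIndex, Subgroup.index, Nat.card_eq_fintype_card]
  rw [← h1, Finset.sum_congr rfl fun a _ ↦ key a, sum_add_distrib, h2, add_sub_cancel_left]
  exact B.sum_mem fun a _ ↦ hB _ _ (hx _ (hmem a))

/-- **Gross's Prop. 3.6 coset transfer for Kolyvagin's point over a smaller subgroup**: under the hypotheses of
`KolyvaginEuler.smul_kolyvaginPoint_sub_mem` for `(σ, H)` (`H` generated by the `σ_ℓ`, `σ_ℓ^{ℓ+1} = 1`, `n ∣ ℓ + 1`, `Tr_ℓ y ∈ nA`), for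
every `H′ ≤ H` and every section `f′` of `𝒢 → 𝒢∕H′`: `P(σ, H′, f′) − [H : H′]·P(σ, H, f) ∈ nA`.
[cite: GrossLMS1991, Prop. 3.6, §4 (4.1)] [cite: McCallumLMS1991, §4 (4)] -/
theorem kolyvaginPoint_sub_relIndex_smul_kolyvaginPoint_mem {𝒢 : Type*} [CommGroup 𝒢] {A : Type*} [AddCommGroup A]
    [DistribMulAction 𝒢 A] {σ : ℕ → 𝒢} {L : Finset ℕ} {n : ℤ} {H H' : Subgroup 𝒢} [Fintype (𝒢 ⧸ H)]
    [Fintype (𝒢 ⧸ H')] (hle : H' ≤ H) {f : 𝒢 ⧸ H → 𝒢} (hf : ∀ q, (f q : 𝒢 ⧸ H) = q)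
    {f' : 𝒢 ⧸ H' → 𝒢} (hf' : ∀ q, (f' q : 𝒢 ⧸ H') = q)
    (hgen : H ≤ Subgroup.closure (σ '' (L : Set ℕ)))
    (hord : ∀ ℓ ∈ L, σ ℓ ^ (ℓ + 1) = 1) (hdvd : ∀ ℓ ∈ L, n ∣ ((ℓ + 1 : ℕ) : ℤ)) {y : A}
    (htr : ∀ ℓ ∈ L, grAct A (traceElt (σ ℓ) ℓ) y ∈ zsmulRange A n) :
    kolyvaginPoint σ L f' y - (H'.relIndex H : ℤ) • kolyvaginPoint σ L f y ∈ zsmulRange A n := by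
  unfold kolyvaginPoint
  refine sum_section_smul_sub_relIndex_smul_sum_mem hle (fun g b hb ↦ smul_mem_zsmulRange g hb)
    (fun h hh ↦ ?_) f hf f' hf'
  refine smul_sub_mem_of_mem_closure (fun g b hb ↦ smul_mem_zsmulRange g hb) ?_ (hgen hh)
  rintro _ ⟨ℓ, hℓ, rfl⟩
  exact smul_grAct_derivProd_sub_mem hord hdvd htr hℓ

end Summit.BirchSwinnertonDyer.BirchSwinnertonDyer.Theorems.KolyvaginCoset

/-! ### §2–§3 The concrete transfer in the ring-class frame of shim-p1's K4d -/

namespace Summit.BirchSwinnertonDyer.BirchSwinnertonDyer.Theorems.ShimuraWalk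

open WeierstrassCurve Field NumberField IsDedekindDomain Finset
  Literature.NumberTheory.EllipticCurves Literature.NumberTheory.GaloisRepresentations
  Literature.NumberTheory.EllipticCurves.KolyvaginCocycle
  Literature.NumberTheory.EllipticCurves.KolyvaginEuler
  Literature.NumberTheory.EllipticCurves.RingClassField
  Literature.NumberTheory.EllipticCurves.ModularForms
  Summit.BirchSwinnertonDyer.Rank1Residual.X11b
  Summit.BirchSwinnertonDyer.BirchSwinnertonDyer.Theorems

variable {K : Type} [Field K] [NumberField K] {W : WeierstrassCurve ℚ}

/-- **`P₂ = c • P₁ + p^M • b` for a transversal presentation `(σ₁, H₁, f₁, S₁)` and an ARBITRARY presentation `(σ₂, H₂ ≤ H_c, f₂)`** of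
Kolyvagin's operator at a square-free level `k` on Kolyvagin primes of depth `M` (frame and labels VERBATIM those of shim-p1's K4d
`exists_isCoprime_kolyvaginPoint_eq_of_presentations_of_pow_eq_one`; presentation 2 carries no transversal, only `σ₂_q^{q+1} = 1`,
`⟨σ₂_q⟩ ↦ G(q)`, `H₂ ↦ ≤ G_k`, `f₂` a section). `c = [H_c : H₂]·u` with `u` K4d's rescaling unit; only `∃ c` is recorded.
[cite: GrossLMS1991, Prop. 3.6, §4 (4.1)] [cite: McCallumLMS1991, §4 (4)] -/
theorem exists_kolyvaginPoint_eq_smul_add_of_presentation (hK : IsImaginaryQuadratic K)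
    (ι : K →+* ℂ) {N : ℕ} [NeZero N] [W.IsElliptic] [W.IsGloballyMinimal]
    (Dt : ModularParametrizationData W N) {p M : ℕ} (hp : p.Prime) (hM : 1 ≤ M)
    {k : ℕ} (hk : Squarefree k)
    (hkol : ∀ q ∈ k.primeFactors, IsKolyvaginPrime N W K p q ∧ FrobEqFrobInfty W K (p ^ M) q)
    {𝒢 : Type*} [CommGroup 𝒢] [Finite 𝒢] {A₀ : Type*} [AddCommGroup A₀] [DistribMulAction 𝒢 A₀]
    (ρ : 𝒢 →* (ringClassField K ι k ≃ₐ[ℚ] ringClassField K ι k)) (hρ : Function.Injective ρ)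
    (h𝒢ρ : ∀ g : 𝒢, ρ g ∈ ringClassGal ι k)
    (iA : A₀ ≃+ (W.baseChange (ringClassField K ι k)).toAffine.Point)
    (hiA : ∀ (g : 𝒢) (a : A₀), iA (g • a) = pointGalHom W (ringClassField K ι k) (ρ g) (iA a))
    (y : A₀)
    (hB4 : ∀ ℓ ∈ k.primeFactors, ∀ σ : ringClassField K ι k ≃ₐ[ℚ] ringClassField K ι k,
      Subgroup.zpowers σ = ringClassGalOver ι k (k / ℓ) →
      ∃ y' : (W.baseChange (ringClassField K ι k)).toAffine.Point,
        ∑ i ∈ Finset.range (ℓ + 1), pointGalHom W (ringClassField K ι k) (σ ^ i) (iA y) =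
          W.frobeniusTrace ℓ • y')
    (σ₁ : ℕ → 𝒢) (H₁ : Subgroup 𝒢) [Fintype (𝒢 ⧸ H₁)] (f₁ : 𝒢 ⧸ H₁ → 𝒢)
    (S₁ : Finset (ringClassField K ι k ≃ₐ[ℚ] ringClassField K ι k))
    (hH₁ : ∀ h ∈ H₁, ρ h ∈ ringClassGalOver ι k 1) (hf₁ : ∀ c, (f₁ c : 𝒢 ⧸ H₁) = c)
    (hf₁S : ∀ c, ρ (f₁ c) ∈ S₁) (hS₁sub : ∀ s ∈ S₁, s ∈ ringClassGal ι k)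
    (hS₁ρ : (S₁ : Set (ringClassField K ι k ≃ₐ[ℚ] ringClassField K ι k)) ⊆ Set.range ρ)
    (hS₁tr : ∀ g ∈ ringClassGal ι k, ∃! s, s ∈ S₁ ∧ g⁻¹ * s ∈ ringClassGalOver ι k 1)
    (hz₁ : ∀ q ∈ k.primeFactors, (Subgroup.zpowers (σ₁ q)).map ρ = ringClassGalOver ι k (k / q))
    (hord₁ : ∀ q ∈ k.primeFactors, σ₁ q ^ (q + 1) = 1)
    (σ₂ : ℕ → 𝒢) (H₂ : Subgroup 𝒢) [Fintype (𝒢 ⧸ H₂)] (f₂ : 𝒢 ⧸ H₂ → 𝒢)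
    (hH₂ : ∀ h ∈ H₂, ρ h ∈ ringClassGalOver ι k 1) (hf₂ : ∀ c, (f₂ c : 𝒢 ⧸ H₂) = c)
    (hz₂ : ∀ q ∈ k.primeFactors, (Subgroup.zpowers (σ₂ q)).map ρ = ringClassGalOver ι k (k / q))
    (hord₂ : ∀ q ∈ k.primeFactors, σ₂ q ^ (q + 1) = 1) :
    ∃ (c : ℤ) (b : A₀), kolyvaginPoint σ₂ k.primeFactors f₂ y =
      c • kolyvaginPoint σ₁ k.primeFactors f₁ y + ((p ^ M : ℕ) : ℤ) • b := by
  -- the canonical subgroup `H_c = ρ⁻¹(G_k)` and a section valued in `S₁`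
  set Hc : Subgroup 𝒢 := (ringClassGalOver ι k 1).comap ρ with hHc
  letI : Fintype (𝒢 ⧸ Hc) := Fintype.ofFinite _
  have hHc' : ∀ h ∈ Hc, ρ h ∈ ringClassGalOver ι k 1 := fun h hh ↦ Subgroup.mem_comap.mp hh
  have hle : H₂ ≤ Hc := fun h hh ↦ Subgroup.mem_comap.mpr (hH₂ h hh)
  obtain ⟨g, hg, hgS⟩ := exists_section_comap_of_transversal ι k ρ h𝒢ρ hS₁ρ hS₁tr
  -- K4d between `(σ₁, H₁, f₁, S₁)` and `(σ₂, H_c, g, S₁)`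
  obtain ⟨u, -, b, hb⟩ := exists_isCoprime_kolyvaginPoint_eq_of_presentations_of_pow_eq_one hK ι Dt hp hM
    hk hkol ρ hρ h𝒢ρ iA hiA y hB4 σ₁ H₁ f₁ S₁ hH₁ hf₁ hf₁S hS₁sub hS₁ρ hS₁tr hz₁ hord₁ σ₂ Hc g S₁ hHc' hg hgS
    hS₁sub hS₁ρ hS₁tr hz₂
  -- the Euler hypotheses for `(σ₂, H_c)`
  have hzz : ∀ q ∈ k.primeFactors, Subgroup.zpowers (ρ (σ₂ q)) = ringClassGalOver ι k (k / q) :=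
    fun q hq ↦ by rw [← MonoidHom.map_zpowers]; exact hz₂ q hq
  have hgen : Hc ≤ Subgroup.closure (σ₂ '' (k.primeFactors : Set ℕ)) :=
    le_closure_of_map_zpowers hK ι hk σ₂ Hc ρ hρ hz₂ hHc'
  have hdvd : ∀ ℓ ∈ k.primeFactors, ((p ^ M : ℕ) : ℤ) ∣ ((ℓ + 1 : ℕ) : ℤ) :=
    fun ℓ hℓ ↦ (IsKolyvaginPrime.pow_dvd_add_one W hp (hkol ℓ hℓ).1 hM (hkol ℓ hℓ).2).1
  have htr : ∀ ℓ ∈ k.primeFactors,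
      grAct A₀ (traceElt (σ₂ ℓ) ℓ) y ∈ zsmulRange A₀ ((p ^ M : ℕ) : ℤ) := by
    intro ℓ hℓ
    obtain ⟨y', hy'⟩ := hB4 ℓ hℓ (ρ (σ₂ ℓ)) (hzz ℓ hℓ)
    have haℓ := pow_dvd_frobeniusTrace_of_kolyvaginPrime (K := K) Dt hp hM (hkol ℓ hℓ).1 (hkol ℓ hℓ).2
    have hrel : grAct A₀ (traceElt (σ₂ ℓ) ℓ) y = W.frobeniusTrace ℓ • iA.symm y' := by
      apply iA.injective
      rw [grAct_traceElt, map_sum, map_zsmul, AddEquiv.apply_symm_apply]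
      simp_rw [hiA, map_pow ρ]
      exact hy'
    exact grAct_traceElt_mem_of_eq_smul hrel haℓ
  -- §1 between `(σ₂, H_c, g)` and `(σ₂, H₂, f₂)`
  obtain ⟨b', hb'⟩ := mem_zsmulRange_iff.mp
    (KolyvaginCoset.kolyvaginPoint_sub_relIndex_smul_kolyvaginPoint_mem hle hg hf₂ hgen hord₂ hdvd htr)
  refine ⟨(H₂.relIndex Hc : ℤ) * u, (H₂.relIndex Hc : ℤ) • b + b', ?_⟩
  have hP₂ : kolyvaginPoint σ₂ k.primeFactors f₂ y =
      (H₂.relIndex Hc : ℤ) • kolyvaginPoint σ₂ k.primeFactors g y + ((p ^ M : ℕ) : ℤ) • b' := by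
    rw [hb']
    abel
  rw [hP₂, hb, smul_add, smul_smul, smul_add ((p ^ M : ℕ) : ℤ), smul_comm (H₂.relIndex Hc : ℤ) ((p ^ M : ℕ) : ℤ) b,
    add_assoc]

/-- **«ONE ⟹ ALL» divisibility transfer** (`μ ≤ M`): if the Kolyvagin point of a transversal presentation is `p^μ`-divisible, so is
the Kolyvagin point of EVERY presentation `(σ₂, H₂ ≤ H_c, f₂)` — the converse of the carrier's clause (1) for `ShimuraWalk.PDiv`.
[cite: GrossLMS1991, Prop. 3.6, §4 (4.1)] [cite: McCallumLMS1991, §5 p. 303] -/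
theorem exists_smul_eq_kolyvaginPoint_of_presentation (hK : IsImaginaryQuadratic K)
    (ι : K →+* ℂ) {N : ℕ} [NeZero N] [W.IsElliptic] [W.IsGloballyMinimal]
    (Dt : ModularParametrizationData W N) {p M : ℕ} (hp : p.Prime) (hM : 1 ≤ M)
    {k : ℕ} (hk : Squarefree k)
    (hkol : ∀ q ∈ k.primeFactors, IsKolyvaginPrime N W K p q ∧ FrobEqFrobInfty W K (p ^ M) q)
    {𝒢 : Type*} [CommGroup 𝒢] [Finite 𝒢] {A₀ : Type*} [AddCommGroup A₀] [DistribMulAction 𝒢 A₀]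
    (ρ : 𝒢 →* (ringClassField K ι k ≃ₐ[ℚ] ringClassField K ι k)) (hρ : Function.Injective ρ)
    (h𝒢ρ : ∀ g : 𝒢, ρ g ∈ ringClassGal ι k)
    (iA : A₀ ≃+ (W.baseChange (ringClassField K ι k)).toAffine.Point)
    (hiA : ∀ (g : 𝒢) (a : A₀), iA (g • a) = pointGalHom W (ringClassField K ι k) (ρ g) (iA a))
    (y : A₀)
    (hB4 : ∀ ℓ ∈ k.primeFactors, ∀ σ : ringClassField K ι k ≃ₐ[ℚ] ringClassField K ι k,
      Subgroup.zpowers σ = ringClassGalOver ι k (k / ℓ) →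
      ∃ y' : (W.baseChange (ringClassField K ι k)).toAffine.Point,
        ∑ i ∈ Finset.range (ℓ + 1), pointGalHom W (ringClassField K ι k) (σ ^ i) (iA y) =
          W.frobeniusTrace ℓ • y')
    (σ₁ : ℕ → 𝒢) (H₁ : Subgroup 𝒢) [Fintype (𝒢 ⧸ H₁)] (f₁ : 𝒢 ⧸ H₁ → 𝒢)
    (S₁ : Finset (ringClassField K ι k ≃ₐ[ℚ] ringClassField K ι k))
    (hH₁ : ∀ h ∈ H₁, ρ h ∈ ringClassGalOver ι k 1) (hf₁ : ∀ c, (f₁ c : 𝒢 ⧸ H₁) = c)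
    (hf₁S : ∀ c, ρ (f₁ c) ∈ S₁) (hS₁sub : ∀ s ∈ S₁, s ∈ ringClassGal ι k)
    (hS₁ρ : (S₁ : Set (ringClassField K ι k ≃ₐ[ℚ] ringClassField K ι k)) ⊆ Set.range ρ)
    (hS₁tr : ∀ g ∈ ringClassGal ι k, ∃! s, s ∈ S₁ ∧ g⁻¹ * s ∈ ringClassGalOver ι k 1)
    (hz₁ : ∀ q ∈ k.primeFactors, (Subgroup.zpowers (σ₁ q)).map ρ = ringClassGalOver ι k (k / q))
    (hord₁ : ∀ q ∈ k.primeFactors, σ₁ q ^ (q + 1) = 1)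
    (σ₂ : ℕ → 𝒢) (H₂ : Subgroup 𝒢) [Fintype (𝒢 ⧸ H₂)] (f₂ : 𝒢 ⧸ H₂ → 𝒢)
    (hH₂ : ∀ h ∈ H₂, ρ h ∈ ringClassGalOver ι k 1) (hf₂ : ∀ c, (f₂ c : 𝒢 ⧸ H₂) = c)
    (hz₂ : ∀ q ∈ k.primeFactors, (Subgroup.zpowers (σ₂ q)).map ρ = ringClassGalOver ι k (k / q))
    (hord₂ : ∀ q ∈ k.primeFactors, σ₂ q ^ (q + 1) = 1)
    {μ : ℕ} (hμ : μ ≤ M) (h₁ : ∃ B : A₀, ((p ^ μ : ℕ) : ℤ) • B = kolyvaginPoint σ₁ k.primeFactors f₁ y) :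
    ∃ B : A₀, ((p ^ μ : ℕ) : ℤ) • B = kolyvaginPoint σ₂ k.primeFactors f₂ y := by
  obtain ⟨c, b, hcb⟩ := exists_kolyvaginPoint_eq_smul_add_of_presentation hK ι Dt hp hM hk hkol ρ hρ h𝒢ρ iA hiA
    y hB4 σ₁ H₁ f₁ S₁ hH₁ hf₁ hf₁S hS₁sub hS₁ρ hS₁tr hz₁ hord₁ σ₂ H₂ f₂ hH₂ hf₂ hz₂ hord₂
  obtain ⟨B, hB⟩ := h₁
  refine ⟨c • B + ((p ^ (M - μ) : ℕ) : ℤ) • b, ?_⟩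
  have hpow : ((p ^ M : ℕ) : ℤ) = ((p ^ μ : ℕ) : ℤ) * ((p ^ (M - μ) : ℕ) : ℤ) := by
    rw [← Nat.cast_mul, ← pow_add, Nat.add_sub_cancel' hμ]
  rw [hcb, ← hB, smul_add, smul_comm c, hpow, mul_smul]

end Summit.BirchSwinnertonDyer.BirchSwinnertonDyer.Theorems.ShimuraWalk

end
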